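import Mathlib
import Summits.KontsevichZagierPeriods.Zeta5Search.Families.IntegrabilityCriterion
import Summits.KontsevichZagierPeriods.Zeta5Search.Families.CellularBrownZudilin
import Summits.KontsevichZagierPeriods.Zeta5Search.Families.ConvergentSeating
import Summits.KontsevichZagierPeriods.Zeta5Search.Families.CellularBrownExamples
import Summits.KontsevichZagierPeriods.Zeta5Search.Families.CellularVanishingMiddle
import Summits.KontsevichZagierPeriods.Zeta5Search.Families.CellularTenOdd
import HarnessLib

/-!
# ζ(5) search — Families: convergence of the Brown–Zudilin integral and of the printed plans' basic integrals

HONEST FRAMING: systematic search; no irrationality claim unless certified.  This file contains NO statement about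
the arithmetic nature of a zeta value; it records CONVERGENCE theorems (the analytic half of Brown's criterion,
`Families/IntegrabilityCriterion.lean`, seat P2) at the two anchors of the cellular search:

* **`integrableOn_bz_iff`** — for EVERY `a ∈ ℤ⁸`, the Brown–Zudilin integrand of [BrownZudilin2022, §1 (1)]
  (`Literature…BrownZudilin2022.integrand a`) is integrable on `0 < t₁ < ⋯ < t₅ < 1` IFF the seventeen linear forms
  (3) are non-negative (`BrownZudilin2022.Converges a`); **`cellularIntegral_bz_pos`** — on that polytope
  `I(a) > 0` is a genuine convergent integral.  (Anchors `integrand_bz`, `homogeneous_bz`, `brownConvergent_bz_iff` of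
  `Families/CellularBrownZudilin.lean` + `integrableOn_integrand_iff_brownConvergent`.)  The convergence claim
  "(3) ⇒ (1) converges" of [BrownZudilin2022, §1] ([Brown2016, §5.1–5.2]) is thereby a tree theorem, with its converse.
* **`integrableOn_basic_ofSeating_iff`** — for every printed seating plan `τ` of `n ≥ 3` guests
  (`Brown2016.IsSeating n τ`) and `N ≥ 0`: the basic cellular integral of `ofSeating τ` converges IFF
  `Brown2016.IsConvergent n τ` (Brown's list test) — [Brown2016, §1.5 "It converges if and only if `σ` is a convergent
  permutation", Lemma 3.6], via `brownConvergent_basic_ofSeating_iff` (`Families/ConvergentSeating.lean`).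
* Brown's worked examples [Brown2016, §5.3.1–5.3.3] (`Families/CellularBrownExamples.lean`): **`integrableOn_five_iff`**
  (the `N = 5` family — Beukers/Rhin–Viola `ζ(2)` integrals — converges iff `a_i ≥ 0`), `integrableOn_six_iff`
  (Rhin–Viola `ζ(3)` family), `integrableOn_eight_iff` (generalised `₈π₈`), and the "vanishing in the middle"
  integrals of [BrownZudilin2022, §12] (`Families/CellularVanishingMiddle.lean`): **`integrableOn_vim`**, `vimIntegral_pos`;
  fam-brown9's `π¹⁰_odd ≅ F̃₉` dictionary family (`Families/CellularTenOdd.lean`): `integrableOn_tenOddSym_iff`.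
How to instantiate for any other family of the atlas (`Families/CellularEightAtlas*`): supply the plan's injectivity
(`p8_k_spec.2.1`) and the homogeneity lemma to `integrableOn_integrand_iff_brownConvergent`, then rewrite with the family's
`brownConvergent_…_iff`.  Standard axioms only.
-/

noncomputable section

open MeasureTheory Set Finset

namespace Summit.KontsevichZagierPeriods.Zeta5Search.Families.Cellular

open Literature.NumberTheory.Irrationality

/-! ### The Brown–Zudilin integral -/

/-- `₈π₈^∨` is a bijection of `Fin 8`. -/
theorem pi8dual_bijective : Function.Bijective pi8dual :=
  Finite.injective_iff_bijective.1 pi8dual_injective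

/-- **Convergence of the Brown–Zudilin integral = the seventeen forms**: for every `a ∈ ℤ⁸`, the integrand of
[BrownZudilin2022, (1)] is integrable on the open simplex iff the linear forms (3) are non-negative.
[BrownZudilin2022, §1 (1)–(3); Brown2016, §5.1–5.2, Lemma 3.6] -/
theorem integrableOn_bz_iff (a : Fin 8 → ℤ) :
    IntegrableOn (BrownZudilin2022.integrand a) BrownZudilin2022.openSimplex ↔ BrownZudilin2022.Converges a := by
  have hint : BrownZudilin2022.integrand a = integrand pi8dual (bzNum a) (bzDen a) :=
    funext fun t => (integrand_bz a t).symm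
  rw [← brownConvergent_bz_iff, ← openSimplex_five, hint]
  exact integrableOn_integrand_iff_brownConvergent pi8dual _ _ pi8dual_bijective (homogeneous_bz a)

/-- On the polytope (3) the Brown–Zudilin integral `I(a)` is a POSITIVE convergent integral. -/
theorem cellularIntegral_bz_pos (a : Fin 8 → ℤ) (h : BrownZudilin2022.Converges a) :
    0 < BrownZudilin2022.cellularIntegral a := by
  rw [← integral_bz]
  exact integral_pos_of_brownConvergent pi8dual _ _ (by norm_num) pi8dual_bijective (homogeneous_bz a)
    ((brownConvergent_bz_iff a).2 h)

/-- On the totally symmetric ray `a = (n,…,n)`, `n ≥ 0`, the Brown–Zudilin integrand is integrable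
(the integrals of [BrownZudilin2022, §2]). -/
theorem integrableOn_bz_symmetric {n : ℤ} (hn : 0 ≤ n) :
    IntegrableOn (BrownZudilin2022.integrand fun _ => n) BrownZudilin2022.openSimplex := by
  rw [integrableOn_bz_iff, converges_iff]
  refine ⟨hn, hn, hn, hn, hn, hn, hn, ?_, ?_, ?_, ?_, ?_, ?_, ?_, ?_, ?_, ?_⟩ <;> linarith

/-! ### Printed seating plans -/

variable {ℓ : ℕ} {τ : List ℕ}

/-- **Brown 2016, §1.5 / Lemma 3.6 for printed plans**: for a seating plan `τ` of `n = ℓ + 3` guests and `N ≥ 0`,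
the basic cellular integral `I_τ(N) = ∫ f_τ^N ω_τ` converges (the integrand is integrable on the open simplex) IFF
`τ` passes Brown's list test `IsConvergent`. [Brown2016, §1.5, Lemma 3.6] -/
theorem integrableOn_basic_ofSeating_iff (hτ : Brown2016.IsSeating (ℓ + 3) τ) {N : ℤ} (hN : 0 ≤ N) :
    IntegrableOn (basic (ofSeating (ℓ := ℓ) τ) N) (openSimplex ℓ) ↔ Brown2016.IsConvergent (ℓ + 3) τ := by
  rw [← brownConvergent_basic_ofSeating_iff hτ hN]
  exact integrableOn_integrand_iff_brownConvergent (ofSeating τ) _ _ (bijective_ofSeating hτ)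
    (homogeneous_const (ofSeating τ) N)

/-- For a CONVERGENT printed plan the basic cellular integral `I_τ(N)`, `N ≥ 0`, is positive (`ℓ ≥ 1`, i.e. `n ≥ 4`;
Brown's plans have `n ≥ 5`). -/
theorem integral_basic_ofSeating_pos (hℓ : 1 ≤ ℓ) (hτ : Brown2016.IsSeating (ℓ + 3) τ)
    (hc : Brown2016.IsConvergent (ℓ + 3) τ) {N : ℤ} (hN : 0 ≤ N) :
    0 < integral (ofSeating (ℓ := ℓ) τ) (fun _ => N) (fun _ => N) :=
  integral_pos_of_brownConvergent (ofSeating τ) _ _ hℓ (bijective_ofSeating hτ) (homogeneous_const (ofSeating τ) N)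
    ((brownConvergent_basic_ofSeating_iff hτ hN).2 hc)

/-! ### Brown's worked examples and the Brown–Zudilin §12 family -/

/-- `N = 5` [Brown2016, §5.3.1]: the generalised cellular integral of `(5,2,4,1,3)` (the Beukers/Rhin–Viola `ζ(2)`
family) converges IFF all five exponents are non-negative ("the convergence conditions are exactly `a_i ≥ 0`"). -/
theorem integrableOn_five_iff (a : Fin 5 → ℤ) :
    IntegrableOn (integrand sigma5 a (den5 a)) (openSimplex 2) ↔ ∀ i, 0 ≤ a i := by
  rw [← brownConvergent_five_iff]
  exact integrableOn_integrand_iff_brownConvergent sigma5 _ _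
    (Finite.injective_iff_bijective.1 sigma5_eq_ofSeating.2.2) (homogeneous_five a)

/-- `N = 6` [Brown2016, §5.3.2]: Rhin–Viola's `ζ(3)` family `(1,4,2,6,3,5)` converges IFF Brown's condition holds
(the polytope of `brownConvergent_six_iff`), under the homogeneity relation `a₄ + a₅ = a₁ + a₂`. -/
theorem integrableOn_six_iff (a : Fin 6 → ℤ) (b : ℤ) (hH : a 3 + a 4 = a 0 + a 1) :
    IntegrableOn (integrand sigma6 a (den6 a b)) (openSimplex 3) ↔
      (∀ i, 0 ≤ a i) ∧ 0 ≤ a 3 + b - a 1 ∧ 0 ≤ a 5 + a 1 + a 2 - a 3 - b := by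
  rw [← brownConvergent_six_iff a b hH]
  exact integrableOn_integrand_iff_brownConvergent sigma6 _ _
    (Finite.injective_iff_bijective.1 sigma6_eq_ofSeating.2.1) ((homogeneous_six_iff a b).2 hH)

/-- `N = 8` [Brown2016, §5.3.3]: the generalised `₈π₈` family `(8,2,7,3,6,4,1,5)` converges IFF Brown's condition
holds (the polytope of `brownConvergent_eight_iff`), under the homogeneity relation `a₆ + a₇ + a₈ = a₂ + a₃ + a₄`. -/
theorem integrableOn_eight_iff (a : Fin 8 → ℤ) (b : ℤ) (hH : a 5 + a 6 + a 7 = a 1 + a 2 + a 3) :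
    IntegrableOn (integrand pi8 a (den8 a b)) (openSimplex 5) ↔
      (∀ i, 0 ≤ a i) ∧ 0 ≤ a 0 + b - a 6 ∧ 0 ≤ a 2 + a 3 - a 5 ∧ 0 ≤ a 4 + a 5 + a 6 - b + 1 ∧
        0 ≤ a 0 + a 1 + b - a 5 - a 6 := by
  rw [← brownConvergent_eight_iff a b hH]
  exact integrableOn_integrand_iff_brownConvergent pi8 _ _
    (Finite.injective_iff_bijective.1 pi8_eq_ofSeating.2.1) ((homogeneous_eight_iff a b).2 hH)

/-- [BrownZudilin2022, §12]: the "vanishing in the middle" integrands `∫ f^n ω` of `(10,2,4,1,6,3,8,5,9,7)` are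
integrable on `0 < t₁ < ⋯ < t₇ < 1` for every `n`. -/
theorem integrableOn_vim (n : ℕ) :
    IntegrableOn (BrownZudilin2022.vimIntegrand n) BrownZudilin2022.openSimplex7 := by
  have hint : BrownZudilin2022.vimIntegrand n = basic vim10 n := funext fun t => (basic_vim n t).symm
  rw [hint, ← openSimplex_seven]
  exact (integrableOn_basic_iff_convergent vim10 (Finite.injective_iff_bijective.1 vim10_injective)
    (Int.natCast_nonneg n)).2
      ((brownConvergent_basic_iff_convergent (Finite.injective_iff_bijective.1 vim10_injective)
        (Int.natCast_nonneg n)).1 ((brownConvergent_vim_iff (n : ℤ)).2 (Int.natCast_nonneg n)))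

/-- [BrownZudilin2022, §12]: the integrals `I_n` of the "vanishing in the middle" family are positive. -/
theorem vimIntegral_pos (n : ℕ) : 0 < BrownZudilin2022.vimIntegral n := by
  rw [← integral_vim]
  exact integral_pos_of_brownConvergent vim10 _ _ (by norm_num) (Finite.injective_iff_bijective.1 vim10_injective)
    (homogeneous_const vim10 (n : ℤ)) ((brownConvergent_vim_iff (n : ℤ)).2 (Int.natCast_nonneg n))

/-- fam-brown9's dictionary family `π¹⁰_odd` (`Families/CellularTenOdd.lean`): the generalised cellular integral of
`(1,3,7,2,8,6,9,5,10,4)` with exponents `tenOddA s / tenOddB s` converges IFF the sixteen-inequality polytope of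
`brownConvergent_tenOddSym_iff` holds. -/
theorem integrableOn_tenOddSym_iff (s : Fin 10 → ℤ) :
    IntegrableOn (integrand tenOddSym (tenOddA s) (tenOddB s)) (openSimplex 7) ↔
      BrownConvergent tenOddSym (tenOddA s) (tenOddB s) :=
  integrableOn_integrand_iff_brownConvergent tenOddSym _ _
    (Finite.injective_iff_bijective.1 tenOddSym_plan.2.1) (homogeneous_tenOddSym s)

end Summit.KontsevichZagierPeriods.Zeta5Search.Families.Cellular
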